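import Mathlib
import Summits.ValiantsHypothesis.ValiantsHypothesis.Theses.FreeSubtorus
import Summits.ValiantsHypothesis.ValiantsHypothesis.Theorems.BorderApolarityToricWitnessObstructionQPStubTorusBound
import Literature.Computability.AlgebraicComplexity.DeterminantalComplexityProofs
import Literature.Computability.AlgebraicComplexity.StandardFamiliesProofs
import Literature.Computability.AlgebraicComplexity.LRPencilOfMatrix
import Literature.Computability.AlgebraicComplexity.GrenetEquivariant

/-!
# `SubtorusCovering` — line `pair-sacrifice` (skeleton) for crux stmt-ValiantsHypothesis-16134 of
# route-ValiantsHypothesis-FreeSubtorus (rank 3)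

Crux, BY NAME: `Summit.ValiantsHypothesis.ValiantsHypothesis.Theses.FreeSubtorus.SubtorusCovering` —
for `n ≥ 3`, every affine determinantal representation `B` of `per_n` over `ℂ` (size `m`) that is
equivariant with exact `GL_m × GL_m` lifts (`IsEquivariantDetRepr`) for the subtorus
`T_Λ = closure {diag(d_k e_l) : ∏_k d_k^{Λ_i(inl k)} ∏_l e_l^{Λ_i(inr l)} = 1 (i < r)}` of the row–column
torus, `Λ : Fin r → (Fin n ⊕ Fin n) → ℤ` admissible (zero row-sums and zero column-sums), satisfies
`C(n, ⌊n/2⌋) ≤ m · 2^r`.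

## The line: PAIR SACRIFICE (crux idea card `Ideas/pair-sacrifice.md`, ideator 2, round 1)

Absorb the torus relations by sacrificing `s ≤ r` row–column pairs and import the LANDED `r = 0`
theorem.  Write `a_k = Λ(·)(inl k)`, `b_l = Λ(·)(inr l) ∈ ℤ^r` for the columns of `Λ` and
`v_{kl} = a_k - b_l` for their differences.

(1) MATCHING (`stub_indepMatching`).  A maximum-cardinality partial matching
`P = {(ι j, κ j) : j < s}` (distinct rows, distinct columns) whose differences `v_j = a_{ι j} - b_{κ j}`
are `ℚ`-linearly independent has `s ≤ r`, and EITHER `n ≤ s + 2` OR every column of `Λ` is a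
`ℚ`-combination of the `v_j` (cleared to one common denominator `N > 0`).  Proof (zero ROW-sums
only): maximality puts every free `v_{kl}` in `S = span P`, so all free `a_k`, `b_l` are congruent
to one class `c` mod `S`; if `S ≠ W = span{v_{kl}}` some matched `a_{ι j}` is `≢ c`, and then one of
the two swaps `(ι j, κ j) ↦ {(ι j, l), (k, κ j)}` (when `v_j + v_{kl} ∉ span(P ∖ j)`) or
`(ι j, κ j) ↦ {(ι j, l'), (k, l)}` (otherwise; then `v_{kl} ∉ span(P ∖ j)`) enlarges `P` — it needs
one free row and two free columns, i.e. `n - s ≥ 2`; finally `n · a_k = Σ_{k'} (v_{kl} - v_{k'l}) ∈ W`.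
(2) RELABEL (`stub_relabel`).  Permuting rows by `ρ` and columns by `κ` (`rename (Prod.map ρ κ)`)
turns a `T_Λ`-equivariant representation of `per_n` into a `T_{Λ ∘ (ρ⁻¹ ⊔ κ⁻¹)}`-equivariant one;
used to move the sacrificed pairs to the last `s` diagonal positions `(natAdd n' j, natAdd n' j)`.
(3) TORUS EXTENSION (`stub_torusExtension`).  If `N a_k = Σ_j n_{kj} v_j` and `N b_l = Σ_j n'_{lj} v_j`
for the free `k, l < n'` (`v_j` = difference at the `j`-th sacrificed diagonal pair), then for all
`d'', e'' ∈ (ℂˣ)^{n'}` the element `d = (d''^N, A⁻¹)`, `e = (e''^N, A)` with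
`A_j = ∏_k d''_k^{n_{kj}} ∏_l e''_l^{n'_{lj}}` satisfies all `r` relations and `d_{n'+j} e_{n'+j} = 1`
(the exponent of relation `i` is `Σ_j V_{ij} (log A_j - log A_j) = 0`).
(4) SUBSTITUTION (`stub_substPer`, `stub_substLifts`).  The algebra map `aeval g`,
`g (k, l) = X_{kl}`, `g (n'+j, n'+j) = 1`, `g = 0` elsewhere on the sacrificed rows and columns,
sends `per_{n'+s}` to `per_{n'}` (block identity of the permanent) and intertwines the diagonal
substitution by any extension `(d, e)` of `(d', e')` with `d_{n'+j} e_{n'+j} = 1` with the diagonal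
substitution by `(d', e')`; hence every generator `diag(d'_k e'_l)` of the FULL two-sided torus of
`per_{n'}` lifts for `B.map (aeval g)` — every generator is an `N`-th power (roots in `ℂ`), and `N`-th
powers extend by (3).
(5) COMPOSITION (kernel-checked below).  If `n ≤ s + 2` then `r ≥ s ≥ n - 2` and `m ≥ n`
(`totalDegree_le_of_hasDetRepr_holds`, `totalDegree_perPoly_holds`) give
`C(n,⌊n/2⌋) ≤ 2^{n-1} ≤ n·2^{n-2} ≤ m·2^r`.  Otherwise `n = n' + s` with `n' ≥ 3`, and the LANDED
`Theorems.BorderApolarityToricWitnessObstructionQP.stub_torusBound` (`RigidityForcesSymmetry.TorusBound`,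
stmt-4164 ≡ RigidMinimalReps.TorusBound stmt-5114, `r = 0`) applied to the substituted, relabelled
representation (same size `m`, `per_{n'}`, full two-sided torus by `IsEquivariantDetRepr.of_generators`)
gives `2^{n'} - 1 ≤ m`, whence `C(n,⌊n/2⌋) ≤ 2^{n-1} ≤ (2^{n'} - 1)·2^s ≤ m·2^r`.

## Shape
* `Stmt.stub_…` — the five stub statements as precise `Prop`s, named like the stubs;
* `stub_…` — the same statements as sorried theorems (the REGISTERED stubs; `sorry` occurs nowhere else);
* `SubtorusCovering_of` — the composition, real proof; `SubtorusCovering_proof` — the crux by name.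
Each stub lands as `Theorems/FreeSubtorusSubtorusCovering<Stub>.lean --supports stmt-ValiantsHypothesis-16134`.

**Disproof used.** None exists (payload `disproof_path` absent 2026-08-17; no `Negative/`, no dead lines).
-/

namespace Summit.ValiantsHypothesis.ValiantsHypothesis.Cruxes.SubtorusCovering.PairSacrifice

open Matrix MvPolynomial Finset
open Literature.Computability.AlgebraicComplexity

-- `Summit.ValiantsHypothesis.ValiantsHypothesis.…` is the tree's mandated single-conjunct layout (Sub = Summit).
set_option linter.dupNamespace false

noncomputable section

/-! ## §1 The stub statements as `Prop`s -/

/-- Statement of stub 1 (`stub_indepMatching`) — **a maximum independent partial matching of the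
difference vectors either leaves at most two rows free or spans every column of `Λ`.**  For
`Λ : Fin r → (Fin n ⊕ Fin n) → ℤ` with zero row-sums there are `s ≤ r` and injections
`ι κ : Fin s ↪ Fin n` (the sacrificed rows / columns) such that either `n ≤ s + 2`, or for one
`N > 0` every column `N • Λ(·)(inl k)` and `N • Λ(·)(inr l)` is an integer combination of the
differences `Λ(·)(inl (ι j)) - Λ(·)(inr (κ j))`. [folklore] -/
def Stmt.stub_indepMatching : Prop :=
  ∀ (n r : ℕ) (Λ : Fin r → (Fin n ⊕ Fin n) → ℤ),
    (∀ i, (∑ k, Λ i (Sum.inl k)) = 0) →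
    ∃ (s : ℕ) (ι κ : Fin s ↪ Fin n), s ≤ r ∧
      (n ≤ s + 2 ∨
        ∃ N : ℕ, 0 < N ∧
          (∀ k : Fin n, ∃ a : Fin s → ℤ, ∀ i,
            (N : ℤ) * Λ i (Sum.inl k) =
              ∑ j, a j * (Λ i (Sum.inl (ι j)) - Λ i (Sum.inr (κ j)))) ∧
          (∀ l : Fin n, ∃ a : Fin s → ℤ, ∀ i,
            (N : ℤ) * Λ i (Sum.inr l) =
              ∑ j, a j * (Λ i (Sum.inl (ι j)) - Λ i (Sum.inr (κ j)))))

/-- Statement of stub 2 (`stub_relabel`) — **`T_Λ`-equivariance is transported by a relabelling of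
rows and columns** (`x_{kl} ↦ x_{ρ k, κ l}`, `Λ ↦ Λ ∘ (ρ⁻¹ ⊔ κ⁻¹)`). [folklore] -/
def Stmt.stub_relabel : Prop :=
  ∀ (n r m : ℕ) (Λ : Fin r → (Fin n ⊕ Fin n) → ℤ)
    (B : Matrix (Fin m) (Fin m) (MvPolynomial (Fin n × Fin n) ℂ)) (ρ κ : Equiv.Perm (Fin n)),
    IsEquivariantDetRepr (Subgroup.closure {γ : Matrix.GeneralLinearGroup (Fin n × Fin n) ℂ |
        ∃ d e : Fin n → ℂˣ,
          (∀ i, (∏ k, (d k) ^ (Λ i (Sum.inl k))) * (∏ l, (e l) ^ (Λ i (Sum.inr l))) = 1) ∧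
          (γ : Matrix (Fin n × Fin n) (Fin n × Fin n) ℂ) =
            Matrix.diagonal (fun p => (d p.1 : ℂ) * (e p.2 : ℂ))})
      (perPoly (Fin n) ℂ) B →
    IsEquivariantDetRepr (Subgroup.closure {γ : Matrix.GeneralLinearGroup (Fin n × Fin n) ℂ |
        ∃ d e : Fin n → ℂˣ,
          (∀ i, (∏ k, (d k) ^ (Λ i (Sum.inl (ρ.symm k)))) *
              (∏ l, (e l) ^ (Λ i (Sum.inr (κ.symm l)))) = 1) ∧
          (γ : Matrix (Fin n × Fin n) (Fin n × Fin n) ℂ) =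
            Matrix.diagonal (fun p => (d p.1 : ℂ) * (e p.2 : ℂ))})
      (perPoly (Fin n) ℂ) (B.map (MvPolynomial.rename (Prod.map ρ κ)))

/-- Statement of stub 3 (`stub_torusExtension`) — **`N`-th powers of the free torus extend to
`T_Λ` across the sacrificed diagonal pairs** when the free columns of `Λ` are integer combinations
(denominator `N`) of the sacrificed differences. [folklore] -/
def Stmt.stub_torusExtension : Prop :=
  ∀ (n' s r : ℕ) (Λ : Fin r → (Fin (n' + s) ⊕ Fin (n' + s)) → ℤ) (N : ℕ), 0 < N →
    (∀ k : Fin n', ∃ a : Fin s → ℤ, ∀ i,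
      (N : ℤ) * Λ i (Sum.inl (Fin.castAdd s k)) =
        ∑ j, a j * (Λ i (Sum.inl (Fin.natAdd n' j)) - Λ i (Sum.inr (Fin.natAdd n' j)))) →
    (∀ l : Fin n', ∃ a : Fin s → ℤ, ∀ i,
      (N : ℤ) * Λ i (Sum.inr (Fin.castAdd s l)) =
        ∑ j, a j * (Λ i (Sum.inl (Fin.natAdd n' j)) - Λ i (Sum.inr (Fin.natAdd n' j)))) →
    ∀ d' e' : Fin n' → ℂˣ, ∃ d e : Fin (n' + s) → ℂˣ,
      (∀ i, (∏ k, (d k) ^ (Λ i (Sum.inl k))) * (∏ l, (e l) ^ (Λ i (Sum.inr l))) = 1) ∧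
      (∀ k, d (Fin.castAdd s k) = d' k ^ N) ∧
      (∀ l, e (Fin.castAdd s l) = e' l ^ N) ∧
      (∀ j, d (Fin.natAdd n' j) * e (Fin.natAdd n' j) = 1)

/-- Statement of stub 4 (`stub_substPer`) — **the pair-sacrifice substitution sends `per_{n'+s}`
to `per_{n'}`**: `g` is `X_{kl}` on the free block, the identity pattern on the sacrificed diagonal
and `0` elsewhere on sacrificed rows/columns. [folklore] -/
def Stmt.stub_substPer : Prop :=
  ∀ (n' s : ℕ) (g : Fin (n' + s) × Fin (n' + s) → MvPolynomial (Fin n' × Fin n') ℂ),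
    (∀ k l, g (Fin.castAdd s k, Fin.castAdd s l) = X (k, l)) →
    (∀ k j, g (Fin.castAdd s k, Fin.natAdd n' j) = 0) →
    (∀ j l, g (Fin.natAdd n' j, Fin.castAdd s l) = 0) →
    (∀ j j', g (Fin.natAdd n' j, Fin.natAdd n' j') = if j = j' then 1 else 0) →
    MvPolynomial.aeval g (perPoly (Fin (n' + s)) ℂ) = perPoly (Fin n') ℂ

/-- Statement of stub 5 (`stub_substLifts`) — **every generator of the full two-sided torus of the
free block lifts for the substituted matrix**, given a `T_Λ`-equivariant `B` and the extension
property of the free torus across the sacrificed pairs. [folklore] -/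
def Stmt.stub_substLifts : Prop :=
  ∀ (n' s r m : ℕ) (Λ : Fin r → (Fin (n' + s) ⊕ Fin (n' + s)) → ℤ)
    (B : Matrix (Fin m) (Fin m) (MvPolynomial (Fin (n' + s) × Fin (n' + s)) ℂ))
    (g : Fin (n' + s) × Fin (n' + s) → MvPolynomial (Fin n' × Fin n') ℂ),
    (∀ k l, g (Fin.castAdd s k, Fin.castAdd s l) = X (k, l)) →
    (∀ k j, g (Fin.castAdd s k, Fin.natAdd n' j) = 0) →
    (∀ j l, g (Fin.natAdd n' j, Fin.castAdd s l) = 0) →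
    (∀ j j', g (Fin.natAdd n' j, Fin.natAdd n' j') = if j = j' then 1 else 0) →
    (∀ d' e' : Fin n' → ℂ, (∀ k, d' k ≠ 0) → (∀ l, e' l ≠ 0) →
      ∃ d e : Fin (n' + s) → ℂˣ,
        (∀ i, (∏ k, (d k) ^ (Λ i (Sum.inl k))) * (∏ l, (e l) ^ (Λ i (Sum.inr l))) = 1) ∧
        (∀ k l, (d (Fin.castAdd s k) : ℂ) * (e (Fin.castAdd s l) : ℂ) = d' k * e' l) ∧
        (∀ j, (d (Fin.natAdd n' j) : ℂ) * (e (Fin.natAdd n' j) : ℂ) = 1)) →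
    IsEquivariantDetRepr (Subgroup.closure
        {γ : Matrix.GeneralLinearGroup (Fin (n' + s) × Fin (n' + s)) ℂ |
          ∃ d e : Fin (n' + s) → ℂˣ,
            (∀ i, (∏ k, (d k) ^ (Λ i (Sum.inl k))) * (∏ l, (e l) ^ (Λ i (Sum.inr l))) = 1) ∧
            (γ : Matrix (Fin (n' + s) × Fin (n' + s)) (Fin (n' + s) × Fin (n' + s)) ℂ) =
              Matrix.diagonal (fun p => (d p.1 : ℂ) * (e p.2 : ℂ))})
      (perPoly (Fin (n' + s)) ℂ) B →
    ∀ γ' : Matrix.GeneralLinearGroup (Fin n' × Fin n') ℂ,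
      γ' ∈ {γ' : Matrix.GeneralLinearGroup (Fin n' × Fin n') ℂ | ∃ d' e' : Fin n' → ℂ,
          (γ' : Matrix (Fin n' × Fin n') (Fin n' × Fin n') ℂ) =
            Matrix.diagonal (fun p => d' p.1 * e' p.2)} →
      ∃ g₁ h₁ : GL (Fin m) ℂ,
        Matrix.linSubstEntries γ' (B.map (MvPolynomial.aeval g)) =
          (g₁ : Matrix (Fin m) (Fin m) ℂ).map C * B.map (MvPolynomial.aeval g) *
            ((h₁⁻¹ : GL (Fin m) ℂ) : Matrix (Fin m) (Fin m) ℂ).map C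

/-! ## §2 Registered stubs (the ONLY sorries of this file) -/

/-- **Registered stub 1 = `Stmt.stub_indepMatching`** (maximum independent partial matching of the
differences; two-move augmentation; clearing denominators).  Size M. [folklore] -/
theorem stub_indepMatching :
    ∀ (n r : ℕ) (Λ : Fin r → (Fin n ⊕ Fin n) → ℤ),
    (∀ i, (∑ k, Λ i (Sum.inl k)) = 0) →
    ∃ (s : ℕ) (ι κ : Fin s ↪ Fin n), s ≤ r ∧
      (n ≤ s + 2 ∨
        ∃ N : ℕ, 0 < N ∧
          (∀ k : Fin n, ∃ a : Fin s → ℤ, ∀ i,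
            (N : ℤ) * Λ i (Sum.inl k) =
              ∑ j, a j * (Λ i (Sum.inl (ι j)) - Λ i (Sum.inr (κ j)))) ∧
          (∀ l : Fin n, ∃ a : Fin s → ℤ, ∀ i,
            (N : ℤ) * Λ i (Sum.inr l) =
              ∑ j, a j * (Λ i (Sum.inl (ι j)) - Λ i (Sum.inr (κ j))))) := by
  sorry

/-- **Registered stub 2 = `Stmt.stub_relabel`** (row/column relabelling of a `T_Λ`-equivariant
representation of `per_n`).  Size M. [folklore] -/
theorem stub_relabel :
    ∀ (n r m : ℕ) (Λ : Fin r → (Fin n ⊕ Fin n) → ℤ)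
    (B : Matrix (Fin m) (Fin m) (MvPolynomial (Fin n × Fin n) ℂ)) (ρ κ : Equiv.Perm (Fin n)),
    IsEquivariantDetRepr (Subgroup.closure {γ : Matrix.GeneralLinearGroup (Fin n × Fin n) ℂ |
        ∃ d e : Fin n → ℂˣ,
          (∀ i, (∏ k, (d k) ^ (Λ i (Sum.inl k))) * (∏ l, (e l) ^ (Λ i (Sum.inr l))) = 1) ∧
          (γ : Matrix (Fin n × Fin n) (Fin n × Fin n) ℂ) =
            Matrix.diagonal (fun p => (d p.1 : ℂ) * (e p.2 : ℂ))})
      (perPoly (Fin n) ℂ) B →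
    IsEquivariantDetRepr (Subgroup.closure {γ : Matrix.GeneralLinearGroup (Fin n × Fin n) ℂ |
        ∃ d e : Fin n → ℂˣ,
          (∀ i, (∏ k, (d k) ^ (Λ i (Sum.inl (ρ.symm k)))) *
              (∏ l, (e l) ^ (Λ i (Sum.inr (κ.symm l)))) = 1) ∧
          (γ : Matrix (Fin n × Fin n) (Fin n × Fin n) ℂ) =
            Matrix.diagonal (fun p => (d p.1 : ℂ) * (e p.2 : ℂ))})
      (perPoly (Fin n) ℂ) (B.map (MvPolynomial.rename (Prod.map ρ κ))) := by
  sorry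

/-- **Registered stub 3 = `Stmt.stub_torusExtension`** (explicit extension of `N`-th powers of the
free torus across the sacrificed diagonal pairs; `zpow` algebra in `ℂˣ`).  Size M. [folklore] -/
theorem stub_torusExtension :
    ∀ (n' s r : ℕ) (Λ : Fin r → (Fin (n' + s) ⊕ Fin (n' + s)) → ℤ) (N : ℕ), 0 < N →
    (∀ k : Fin n', ∃ a : Fin s → ℤ, ∀ i,
      (N : ℤ) * Λ i (Sum.inl (Fin.castAdd s k)) =
        ∑ j, a j * (Λ i (Sum.inl (Fin.natAdd n' j)) - Λ i (Sum.inr (Fin.natAdd n' j)))) →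
    (∀ l : Fin n', ∃ a : Fin s → ℤ, ∀ i,
      (N : ℤ) * Λ i (Sum.inr (Fin.castAdd s l)) =
        ∑ j, a j * (Λ i (Sum.inl (Fin.natAdd n' j)) - Λ i (Sum.inr (Fin.natAdd n' j)))) →
    ∀ d' e' : Fin n' → ℂˣ, ∃ d e : Fin (n' + s) → ℂˣ,
      (∀ i, (∏ k, (d k) ^ (Λ i (Sum.inl k))) * (∏ l, (e l) ^ (Λ i (Sum.inr l))) = 1) ∧
      (∀ k, d (Fin.castAdd s k) = d' k ^ N) ∧
      (∀ l, e (Fin.castAdd s l) = e' l ^ N) ∧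
      (∀ j, d (Fin.natAdd n' j) * e (Fin.natAdd n' j) = 1) := by
  sorry

/-- **Registered stub 4 = `Stmt.stub_substPer`** (the substitution sends `per_{n'+s}` to
`per_{n'}`: block identity of the permanent).  Size M. [folklore] -/
theorem stub_substPer :
    ∀ (n' s : ℕ) (g : Fin (n' + s) × Fin (n' + s) → MvPolynomial (Fin n' × Fin n') ℂ),
    (∀ k l, g (Fin.castAdd s k, Fin.castAdd s l) = X (k, l)) →
    (∀ k j, g (Fin.castAdd s k, Fin.natAdd n' j) = 0) →
    (∀ j l, g (Fin.natAdd n' j, Fin.castAdd s l) = 0) →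
    (∀ j j', g (Fin.natAdd n' j, Fin.natAdd n' j') = if j = j' then 1 else 0) →
    MvPolynomial.aeval g (perPoly (Fin (n' + s)) ℂ) = perPoly (Fin n') ℂ := by
  sorry

/-- **Registered stub 5 = `Stmt.stub_substLifts`** (generators of the free two-sided torus lift for
the substituted matrix).  Size M. [folklore] -/
theorem stub_substLifts :
    ∀ (n' s r m : ℕ) (Λ : Fin r → (Fin (n' + s) ⊕ Fin (n' + s)) → ℤ)
    (B : Matrix (Fin m) (Fin m) (MvPolynomial (Fin (n' + s) × Fin (n' + s)) ℂ))
    (g : Fin (n' + s) × Fin (n' + s) → MvPolynomial (Fin n' × Fin n') ℂ),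
    (∀ k l, g (Fin.castAdd s k, Fin.castAdd s l) = X (k, l)) →
    (∀ k j, g (Fin.castAdd s k, Fin.natAdd n' j) = 0) →
    (∀ j l, g (Fin.natAdd n' j, Fin.castAdd s l) = 0) →
    (∀ j j', g (Fin.natAdd n' j, Fin.natAdd n' j') = if j = j' then 1 else 0) →
    (∀ d' e' : Fin n' → ℂ, (∀ k, d' k ≠ 0) → (∀ l, e' l ≠ 0) →
      ∃ d e : Fin (n' + s) → ℂˣ,
        (∀ i, (∏ k, (d k) ^ (Λ i (Sum.inl k))) * (∏ l, (e l) ^ (Λ i (Sum.inr l))) = 1) ∧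
        (∀ k l, (d (Fin.castAdd s k) : ℂ) * (e (Fin.castAdd s l) : ℂ) = d' k * e' l) ∧
        (∀ j, (d (Fin.natAdd n' j) : ℂ) * (e (Fin.natAdd n' j) : ℂ) = 1)) →
    IsEquivariantDetRepr (Subgroup.closure
        {γ : Matrix.GeneralLinearGroup (Fin (n' + s) × Fin (n' + s)) ℂ |
          ∃ d e : Fin (n' + s) → ℂˣ,
            (∀ i, (∏ k, (d k) ^ (Λ i (Sum.inl k))) * (∏ l, (e l) ^ (Λ i (Sum.inr l))) = 1) ∧
            (γ : Matrix (Fin (n' + s) × Fin (n' + s)) (Fin (n' + s) × Fin (n' + s)) ℂ) =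
              Matrix.diagonal (fun p => (d p.1 : ℂ) * (e p.2 : ℂ))})
      (perPoly (Fin (n' + s)) ℂ) B →
    ∀ γ' : Matrix.GeneralLinearGroup (Fin n' × Fin n') ℂ,
      γ' ∈ {γ' : Matrix.GeneralLinearGroup (Fin n' × Fin n') ℂ | ∃ d' e' : Fin n' → ℂ,
          (γ' : Matrix (Fin n' × Fin n') (Fin n' × Fin n') ℂ) =
            Matrix.diagonal (fun p => d' p.1 * e' p.2)} →
      ∃ g₁ h₁ : GL (Fin m) ℂ,
        Matrix.linSubstEntries γ' (B.map (MvPolynomial.aeval g)) =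
          (g₁ : Matrix (Fin m) (Fin m) ℂ).map C * B.map (MvPolynomial.aeval g) *
            ((h₁⁻¹ : GL (Fin m) ℂ) : Matrix (Fin m) (Fin m) ℂ).map C := by
  sorry

/-! ## §3 The composition (kernel-checked, sorry-free) -/

/-- An injection `Fin s ↪ Fin N` is the restriction of a permutation carrying it onto any other
injection `Fin s ↪ Fin N`. [folklore] -/
theorem exists_perm_extend {s N : ℕ} (ι τ : Fin s ↪ Fin N) :
    ∃ ρ : Equiv.Perm (Fin N), ∀ j, ρ (ι j) = τ j := by
  classical
  let e : {x // x ∈ Set.range ι} ≃ {x // x ∈ Set.range τ} :=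
    ι.toEquivRange.symm.trans τ.toEquivRange
  refine ⟨e.extendSubtype, fun j => ?_⟩
  rw [Equiv.extendSubtype_apply_of_mem e (ι j) ⟨j, rfl⟩]
  simp only [e, Equiv.trans_apply]
  rw [Function.Embedding.toEquivRange_symm_apply_self, Function.Embedding.toEquivRange_apply]

/-- The middle binomial coefficient is at most half the row sum: `C(N, ⌊N/2⌋) ≤ 2^{N-1}`
(`N ≥ 1`; Pascal and `Σ_i C(N-1, i) = 2^{N-1}`). [folklore] -/
theorem choose_middle_le_two_pow (N : ℕ) (hN : 1 ≤ N) : N.choose (N / 2) ≤ 2 ^ (N - 1) := by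
  obtain ⟨M, rfl⟩ : ∃ M, N = M + 1 := ⟨N - 1, by omega⟩
  simp only [Nat.add_sub_cancel]
  rcases Nat.eq_zero_or_pos ((M + 1) / 2) with h0 | hpos
  · rw [h0, Nat.choose_zero_right]; exact Nat.one_le_two_pow
  · obtain ⟨j, hj⟩ : ∃ j, (M + 1) / 2 = j + 1 := ⟨(M + 1) / 2 - 1, by omega⟩
    rw [hj, Nat.choose_succ_succ, ← Nat.sum_range_choose M]
    have hjM : j + 1 < M + 1 := by omega
    calc M.choose j + M.choose (j + 1) = ∑ i ∈ ({j, j + 1} : Finset ℕ), M.choose i := by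
          rw [Finset.sum_pair (by omega)]
      _ ≤ ∑ i ∈ Finset.range (M + 1), M.choose i := by
          apply Finset.sum_le_sum_of_subset
          intro x hx
          simp only [Finset.mem_insert, Finset.mem_singleton] at hx
          rw [Finset.mem_range]; omega

/-- An algebra map by affine data preserves affineness: if every `g v` has total degree `≤ 1`, so
does `aeval g p` for `p` of total degree `≤ 1`. [folklore] -/
theorem totalDegree_aeval_le_one {σ τ : Type*} [Fintype σ] [DecidableEq σ]
    (g : σ → MvPolynomial τ ℂ) (hg : ∀ v, (g v).totalDegree ≤ 1) (p : MvPolynomial σ ℂ)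
    (hp : p.totalDegree ≤ 1) : (MvPolynomial.aeval g p).totalDegree ≤ 1 := by
  have hφ : MvPolynomial.aeval g p =
      C (coeff 0 p) + ∑ v, C (coeff (Finsupp.single v 1) p) * g v := by
    conv_lhs => rw [LRPencil.eq_affine_of_totalDegree_le_one p hp]
    simp [map_sum, MvPolynomial.algebraMap_eq]
  rw [hφ]
  refine (totalDegree_add _ _).trans (max_le (by simp) ?_)
  refine totalDegree_finsetSum_le fun v _ => (totalDegree_mul _ _).trans ?_
  rw [totalDegree_C, zero_add]
  exact hg v

/-- **The crux from the five stubs** (real proof).  Given admissible `Λ` and a `T_Λ`-equivariant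
affine determinantal representation `B` of `per_n`, `n ≥ 3`, of size `m`: `m ≥ n` by degree;
stub 1 gives `s ≤ r` sacrificed pairs `(ι j, κ j)`; if `n ≤ s + 2` the bound is arithmetic;
otherwise `n = n' + s`, `n' ≥ 3`: relabel so that the pairs are the last `s` diagonal positions
(stub 2), extend `N`-th powers of the free torus (stub 3, roots of unity-free because `ℂ` has
`N`-th roots), substitute (`aeval g`): the result is an affine representation of `per_{n'}` of
size `m` (stub 4) with lifts of every generator of the full two-sided torus (stub 5), hence
(`of_generators`) `TorusBound` applies: `2^{n'} - 1 ≤ m`, and `C(n,⌊n/2⌋) ≤ 2^{n-1} ≤ (2^{n'}-1)2^s ≤ m 2^r`.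
[cite: LandsbergRessayre2017, Thm. 2.8, §6] -/
theorem SubtorusCovering_of :
    Stmt.stub_indepMatching → Stmt.stub_relabel → Stmt.stub_torusExtension → Stmt.stub_substPer →
      Stmt.stub_substLifts →
      Summit.ValiantsHypothesis.ValiantsHypothesis.Theses.FreeSubtorus.SubtorusCovering := by
  intro hIM hRL hTE hSP hSL
  unfold Stmt.stub_indepMatching at hIM
  unfold Stmt.stub_relabel at hRL
  unfold Stmt.stub_torusExtension at hTE
  unfold Stmt.stub_substPer at hSP
  unfold Stmt.stub_substLifts at hSL
  intro n hn m r Λ B hΛ hB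
  classical
  -- (0) the degree bound `n ≤ m`
  have hmn : n ≤ m := by
    have h1 := totalDegree_le_of_hasDetRepr_holds (k := ℂ) (σ := Fin n × Fin n) ⟨B, hB.1⟩
    have h2 : (perPoly (Fin n) ℂ).totalDegree = n := by
      rw [totalDegree_perPoly_holds (n := Fin n) (k := ℂ), Fintype.card_fin]
    rw [h2] at h1
    exact h1
  -- (1) the matching
  obtain ⟨s, ι, κ, hsr, hcase⟩ := hIM n r Λ (fun i => (hΛ i).1)
  by_cases hdeg : n ≤ s + 2
  · -- degenerate ranks: `r ≥ s ≥ n - 2`, `m ≥ n ≥ 3`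
    calc n.choose (n / 2) ≤ 2 ^ (n - 1) := choose_middle_le_two_pow n (by omega)
      _ = 2 * 2 ^ (n - 2) := by rw [← pow_succ']; congr 1; omega
      _ ≤ n * 2 ^ (n - 2) := Nat.mul_le_mul_right _ (by omega)
      _ ≤ m * 2 ^ r := Nat.mul_le_mul hmn (Nat.pow_le_pow_right (by norm_num) (by omega))
  -- main branch
  rcases hcase with h | ⟨N, hN, hrow, hcol⟩
  · exact absurd h hdeg
  obtain ⟨n', rfl⟩ : ∃ n', n = n' + s := ⟨n - s, by omega⟩
  have hn' : 3 ≤ n' := by omega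
  -- (2) relabel: sacrificed pairs to the last `s` diagonal positions
  obtain ⟨ρ, hρ⟩ := exists_perm_extend ι (Fin.natAddEmb n')
  obtain ⟨κ₀, hκ₀⟩ := exists_perm_extend κ (Fin.natAddEmb n')
  have hρ' : ∀ j, ρ.symm (Fin.natAdd n' j) = ι j := fun j => by
    rw [Equiv.symm_apply_eq]; exact (hρ j).symm
  have hκ₀' : ∀ j, κ₀.symm (Fin.natAdd n' j) = κ j := fun j => by
    rw [Equiv.symm_apply_eq]; exact (hκ₀ j).symm
  set Λ' : Fin r → (Fin (n' + s) ⊕ Fin (n' + s)) → ℤ := fun i =>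
    Sum.elim (fun k => Λ i (Sum.inl (ρ.symm k))) (fun l => Λ i (Sum.inr (κ₀.symm l))) with hΛ'
  set B₁ : Matrix (Fin m) (Fin m) (MvPolynomial (Fin (n' + s) × Fin (n' + s)) ℂ) :=
    B.map (MvPolynomial.rename (Prod.map ρ κ₀)) with hB₁def
  have hB₁ : IsEquivariantDetRepr (Subgroup.closure
      {γ : Matrix.GeneralLinearGroup (Fin (n' + s) × Fin (n' + s)) ℂ |
        ∃ d e : Fin (n' + s) → ℂˣ,
          (∀ i, (∏ k, (d k) ^ (Λ' i (Sum.inl k))) * (∏ l, (e l) ^ (Λ' i (Sum.inr l))) = 1) ∧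
          (γ : Matrix (Fin (n' + s) × Fin (n' + s)) (Fin (n' + s) × Fin (n' + s)) ℂ) =
            Matrix.diagonal (fun p => (d p.1 : ℂ) * (e p.2 : ℂ))})
      (perPoly (Fin (n' + s)) ℂ) B₁ :=
    hRL (n' + s) r m Λ B ρ κ₀ hB
  -- (3) the integer relations, relabelled
  have hrow' : ∀ k : Fin n', ∃ a : Fin s → ℤ, ∀ i,
      (N : ℤ) * Λ' i (Sum.inl (Fin.castAdd s k)) =
        ∑ j, a j * (Λ' i (Sum.inl (Fin.natAdd n' j)) - Λ' i (Sum.inr (Fin.natAdd n' j))) := by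
    intro k
    obtain ⟨a, ha⟩ := hrow (ρ.symm (Fin.castAdd s k))
    refine ⟨a, fun i => ?_⟩
    simp only [hΛ', Sum.elim_inl, Sum.elim_inr, hρ', hκ₀']
    exact ha i
  have hcol' : ∀ l : Fin n', ∃ a : Fin s → ℤ, ∀ i,
      (N : ℤ) * Λ' i (Sum.inr (Fin.castAdd s l)) =
        ∑ j, a j * (Λ' i (Sum.inl (Fin.natAdd n' j)) - Λ' i (Sum.inr (Fin.natAdd n' j))) := by
    intro l
    obtain ⟨a, ha⟩ := hcol (κ₀.symm (Fin.castAdd s l))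
    refine ⟨a, fun i => ?_⟩
    simp only [hΛ', Sum.elim_inl, Sum.elim_inr, hρ', hκ₀']
    exact ha i
  -- (4) the extension property of the free torus (roots of `N`-th powers exist in `ℂ`)
  have hext : ∀ d' e' : Fin n' → ℂ, (∀ k, d' k ≠ 0) → (∀ l, e' l ≠ 0) →
      ∃ d e : Fin (n' + s) → ℂˣ,
        (∀ i, (∏ k, (d k) ^ (Λ' i (Sum.inl k))) * (∏ l, (e l) ^ (Λ' i (Sum.inr l))) = 1) ∧
        (∀ k l, (d (Fin.castAdd s k) : ℂ) * (e (Fin.castAdd s l) : ℂ) = d' k * e' l) ∧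
        (∀ j, (d (Fin.natAdd n' j) : ℂ) * (e (Fin.natAdd n' j) : ℂ) = 1) := by
    intro d' e' hd' he'
    choose dr hdr using fun k => IsAlgClosed.exists_pow_nat_eq (d' k) hN
    choose er her using fun l => IsAlgClosed.exists_pow_nat_eq (e' l) hN
    have hdr0 : ∀ k, dr k ≠ 0 := fun k h0 => hd' k (by rw [← hdr k, h0, zero_pow hN.ne'])
    have her0 : ∀ l, er l ≠ 0 := fun l h0 => he' l (by rw [← her l, h0, zero_pow hN.ne'])
    obtain ⟨d, e, hrel, hd, he, hde⟩ := hTE n' s r Λ' N hN hrow' hcol'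
      (fun k => Units.mk0 (dr k) (hdr0 k)) (fun l => Units.mk0 (er l) (her0 l))
    refine ⟨d, e, hrel, fun k l => ?_, fun j => ?_⟩
    · rw [hd k, he l, Units.val_pow_eq_pow_val, Units.val_pow_eq_pow_val, Units.val_mk0,
        Units.val_mk0, hdr k, her l]
    · rw [← Units.val_mul, hde j, Units.val_one]
  -- (5) the substitution
  let g : Fin (n' + s) × Fin (n' + s) → MvPolynomial (Fin n' × Fin n') ℂ := fun p =>
    Fin.addCases (motive := fun _ => MvPolynomial (Fin n' × Fin n') ℂ)
      (fun k => Fin.addCases (motive := fun _ => MvPolynomial (Fin n' × Fin n') ℂ)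
        (fun l => X (k, l)) (fun _ => 0) p.2)
      (fun j => Fin.addCases (motive := fun _ => MvPolynomial (Fin n' × Fin n') ℂ)
        (fun _ => 0) (fun j' => if j = j' then 1 else 0) p.2)
      p.1
  have hg₁ : ∀ k l, g (Fin.castAdd s k, Fin.castAdd s l) = X (k, l) := fun k l => by
    simp [g]
  have hg₂ : ∀ k j, g (Fin.castAdd s k, Fin.natAdd n' j) = 0 := fun k j => by
    simp [g]
  have hg₃ : ∀ j l, g (Fin.natAdd n' j, Fin.castAdd s l) = 0 := fun j l => by
    simp [g]
  have hg₄ : ∀ j j', g (Fin.natAdd n' j, Fin.natAdd n' j') = if j = j' then 1 else 0 :=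
    fun j j' => by simp [g]
  have hgdeg : ∀ p, (g p).totalDegree ≤ 1 := by
    rintro ⟨a, b⟩
    induction a using Fin.addCases <;> induction b using Fin.addCases
    · rw [hg₁]; exact (totalDegree_X _).le
    · rw [hg₂]; simp
    · rw [hg₃]; simp
    · rw [hg₄]; split_ifs <;> simp
  set B₂ : Matrix (Fin m) (Fin m) (MvPolynomial (Fin n' × Fin n') ℂ) :=
    B₁.map (MvPolynomial.aeval g) with hB₂def
  have haff₂ : ∀ i j, (B₂ i j).totalDegree ≤ 1 := fun i j => by
    rw [hB₂def, Matrix.map_apply]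
    exact totalDegree_aeval_le_one g hgdeg _ (hB₁.1.1 i j)
  have hdet₂ : B₂.det = perPoly (Fin n') ℂ := by
    rw [hB₂def, ← AlgHom.mapMatrix_apply, ← AlgHom.map_det, hB₁.1.2, hSP n' s g hg₁ hg₂ hg₃ hg₄]
  have hlifts := hSL n' s r m Λ' B₁ g hg₁ hg₂ hg₃ hg₄ hext hB₁
  have hB₂ : IsEquivariantDetRepr (Subgroup.closure
      {γ' : Matrix.GeneralLinearGroup (Fin n' × Fin n') ℂ | ∃ d' e' : Fin n' → ℂ,
        (γ' : Matrix (Fin n' × Fin n') (Fin n' × Fin n') ℂ) =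
          Matrix.diagonal (fun p => d' p.1 * e' p.2)}) (perPoly (Fin n') ℂ) B₂ :=
    IsEquivariantDetRepr.of_generators ⟨haff₂, hdet₂⟩ hlifts
  -- (6) the landed `r = 0` theorem and the arithmetic
  have hbound : 2 ^ n' - 1 ≤ m :=
    Summit.ValiantsHypothesis.ValiantsHypothesis.Theorems.BorderApolarityToricWitnessObstructionQP.stub_torusBound
      n' hn' m B₂ hB₂
  calc (n' + s).choose ((n' + s) / 2) ≤ 2 ^ (n' + s - 1) := choose_middle_le_two_pow _ (by omega)
    _ = 2 ^ (n' - 1) * 2 ^ s := by rw [← pow_add]; congr 1; omega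
    _ ≤ (2 ^ n' - 1) * 2 ^ s := by
        apply Nat.mul_le_mul_right
        have : 2 ^ n' = 2 * 2 ^ (n' - 1) := by rw [← pow_succ']; congr 1; omega
        omega
    _ ≤ m * 2 ^ r := Nat.mul_le_mul hbound (Nat.pow_le_pow_right (by norm_num) hsr)

/-- **THE SKELETON: the crux BY NAME, modulo exactly the five registered stubs** (the compiler checks
that the `Stmt` copies and the stub statements agree). [cite: LandsbergRessayre2017, Thm. 2.8] -/
theorem SubtorusCovering_proof :
    Summit.ValiantsHypothesis.ValiantsHypothesis.Theses.FreeSubtorus.SubtorusCovering :=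
  SubtorusCovering_of stub_indepMatching stub_relabel stub_torusExtension stub_substPer stub_substLifts

end

end Summit.ValiantsHypothesis.ValiantsHypothesis.Cruxes.SubtorusCovering.PairSacrifice
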